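import Summits.ResolutionOfSingularities.ResolutionOfSingularities.Theses.Valuative
import Literature.AlgebraicGeometry.Resolution.ProperModelsExtension
import Literature.AlgebraicGeometry.Resolution.ProperModelsPatchingGluing
import Literature.AlgebraicGeometry.Resolution.ProperModelsRegLeification
import Literature.AlgebraicGeometry.Resolution.ZariskiPatchingProperModels
import Literature.AlgebraicGeometry.Resolution.GraphClosureCompactification
import Literature.AlgebraicGeometry.Morphisms.OpenGluingProofs
import Literature.AlgebraicGeometry.Morphisms.NagataCompactification

/-!
# drefute gen 4 — stub S6 `stub_nagataCompactification` is OVER-STRONG for the line: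
# Nagata's 1962 theorem for VARIETIES OVER A FIELD suffices (use-site certificate)

The line `sandwiched-gluing` (crux stmt-ResolutionOfSingularities-0642, `Valuative.PatchingRel`)
takes the named fact `NagataCompactification` (Conrad 2007, Thm. 4.1: qcqs base, separated
finite-type morphism). Its ONLY use (`exists_isPullback_of_nagata`, `ProperModelsExtension.lean`)
is at `hN Y P.X (g ≫ U.ι)` with `Y` INTEGRAL of finite type over a field `k` and `P.X` a proper
`k`-scheme. This file proves that the absolute statement over a field for integral schemes —
Nagata 1962, "Imbedding of an abstract variety in a complete variety" — already gives the relative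
statement over every separated finite-type `k`-base (closure of the graph in `Ȳ ×_k X`,
`exists_graphClosure_compactification`), hence the line's stub S5 (extension of proper models),
hence the capstone: `NagataCompactificationOverField → (∀ p prime, SAND⁺ p) → PatchingRel`.
-/

noncomputable section

open CategoryTheory CategoryTheory.Limits AlgebraicGeometry TopologicalSpace Topology
open Literature.AlgebraicGeometry.Resolution Literature.AlgebraicGeometry.Morphisms

namespace DrefuteG4

universe u

/-- **Nagata's embedding theorem for varieties over a field** (Nagata 1962, Thm.: "every abstract
variety over a field can be imbedded as an open subset of a complete variety"): for every field
`k` and every INTEGRAL separated `k`-scheme of finite type `f : Y → Spec k` there are a scheme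
`Yc`, an open immersion `j : Y → Yc` and a proper `g : Yc → Spec k` with `j ≫ g = f`. The special
case `S = Spec k`, `X` integral of `NagataCompactification`. [cite: Nagata1962, Main Theorem] -/
def NagataCompactificationOverField : Prop :=
  ∀ (k : Type u) [Field k] (Y : Scheme.{u}) [IsIntegral Y] (f : Y ⟶ Spec (.of k))
    [IsSeparated f] [LocallyOfFiniteType f] [QuasiCompact f],
    ∃ (Yc : Scheme.{u}) (j : Y ⟶ Yc) (g : Yc ⟶ Spec (.of k)),
      IsOpenImmersion j ∧ IsProper g ∧ j ≫ g = f

/-- The field case is a specialisation of the qcqs-base statement. [folklore] -/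
theorem nagataCompactificationOverField_of_nagataCompactification
    (h : NagataCompactification.{u}) : NagataCompactificationOverField.{u} := by
  intro k _ Y _ f _ _ _
  haveI : QuasiSeparatedSpace (Spec (CommRingCat.of k)) :=
    inferInstanceAs (QuasiSeparatedSpace (Spec (CommRingCat.of k)))
  exact h Y (Spec (.of k)) f

/-- **Relative compactification over a `k`-base from the absolute one** (closure of the graph):
if integral separated finite-type `k`-schemes embed openly into proper `k`-schemes, then every
separated finite-type morphism `f : Y → X` from an integral `Y` to a separated finite-type
`k`-scheme `X` factors as an open immersion followed by a proper morphism: embed `Y ↪ Ȳ` over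
`k`, map `Y` to `Ȳ ×_k X` by `(j₀, f)` and take the scheme-theoretic image
(`exists_graphClosure_compactification`). [folklore] -/
theorem exists_compactification_of_overField (h : NagataCompactificationOverField.{u})
    {k : Type u} [Field k] {X Y : Scheme.{u}} [IsIntegral Y] (πX : X ⟶ Spec (.of k))
    [IsSeparated πX] [LocallyOfFiniteType πX] [QuasiCompact πX]
    (f : Y ⟶ X) [IsSeparated f] [LocallyOfFiniteType f] [QuasiCompact f] :
    ∃ (Xc : Scheme.{u}) (j : Y ⟶ Xc) (g : Xc ⟶ X), IsOpenImmersion j ∧ IsProper g ∧ j ≫ g = f := by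
  -- compactify `Y` over `k`
  obtain ⟨N, j₀, gN, hj₀, hgN, hfac⟩ := h k Y (f ≫ πX)
  haveI := hj₀
  haveI := hgN
  -- `Y` is Noetherian, so every morphism out of it is quasi-compact
  haveI : IsLocallyNoetherian Y := LocallyOfFiniteType.isLocallyNoetherian (f ≫ πX)
  haveI : CompactSpace Y := QuasiCompact.compactSpace_of_compactSpace (f ≫ πX)
  haveI : IsNoetherian Y := {}
  -- the graph of `f` inside `N ×_k X`
  let γ : Y ⟶ pullback gN πX := pullback.lift j₀ f hfac
  have hγ : γ ≫ pullback.fst gN πX = j₀ := pullback.lift_fst _ _ _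
  obtain ⟨Y', c, s, -, hc, hsc, hs, -, -⟩ :=
    exists_graphClosure_compactification j₀ (pullback.fst gN πX) γ hγ
  haveI := hc
  refine ⟨Y', s, c ≫ pullback.snd gN πX, hs, inferInstance, ?_⟩
  rw [← Category.assoc, hsc]
  exact pullback.lift_snd _ _ _

/-- The line's use of Nagata, from the field version: proper integral extension over the base of a
proper scheme over an open (`exists_isPullback_of_nagata` with `NagataCompactification` replaced by
`NagataCompactificationOverField`, for bases `X` separated of finite type over `k`). [folklore] -/
theorem exists_isPullback_of_overField (h : NagataCompactificationOverField.{u})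
    {k : Type u} [Field k] {X : Scheme.{u}} (πX : X ⟶ Spec (.of k))
    [IsSeparated πX] [LocallyOfFiniteType πX] [QuasiCompact πX]
    (U : X.Opens) {Y : Scheme.{u}} [IsIntegral Y] (g : Y ⟶ (U : Scheme.{u})) [IsProper g] :
    ∃ (Z : Scheme.{u}) (ρ : Z ⟶ X) (s : Y ⟶ Z), IsIntegral Z ∧ IsProper ρ ∧
      IsOpenImmersion s ∧ Dense (Set.range s) ∧ IsPullback s g ρ U.ι := by
  haveI : IsLocallyNoetherian X := LocallyOfFiniteType.isLocallyNoetherian πX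
  obtain ⟨Xc, j, gc, hj, hgc, hfac⟩ := exists_compactification_of_overField h πX (g ≫ U.ι)
  haveI := hj
  haveI := hgc
  haveI : IsLocallyNoetherian Xc := LocallyOfFiniteType.isLocallyNoetherian gc
  obtain ⟨Z, c, s, hZ, hc, hsc, hs, hdense, -⟩ :=
    exists_graphClosure_compactification j (𝟙 Xc) j (Category.comp_id j)
  haveI := hZ
  haveI := hc
  haveI := hs
  have hsρ : s ≫ c ≫ gc = g ≫ U.ι := by rw [← Category.assoc, hsc, hfac]
  exact ⟨Z, c ≫ gc, s, hZ, inferInstance, hs, hdense,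
    isPullback_of_isOpenImmersion_of_universallyClosed s g (c ≫ gc) U.ι hsρ⟩

/-- Stub S5 of the line (extension of proper birational modifications over opens of proper
models) from the FIELD version of Nagata. [folklore] -/
theorem extension_of_overField (h : NagataCompactificationOverField.{u}) :
    ∀ (k : Type u) [Field k] (K : Type u) [Field K] [Algebra k K] (P : ProperModel k K)
      (U : P.X.Opens) (Y : Scheme.{u}) [IsIntegral Y] (g : Y ⟶ (U : Scheme.{u})) [IsProper g],
      IsBirational g → ∃ (P' : ProperModel k K) (φ : P'.Hom P) (i : Y ⟶ P'.X),
        IsOpenImmersion i ∧ IsPullback i g φ.f U.ι := by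
  intro k _ K _ _ P U Y _ g _ hg
  haveI : IsProper P.π := P.isProper
  obtain ⟨Z, ρ, s, hZ, hρ, hs, -, hsq⟩ := exists_isPullback_of_overField h P.π U g
  haveI := hZ
  haveI := hρ
  haveI := hs
  obtain ⟨O, hOd, -, hO⟩ := hg
  haveI := hO
  haveI : Nonempty (U : Scheme.{u}) := ⟨g.base (Classical.arbitrary Y)⟩
  have hne : (U.ι ''ᵁ O : Set P.X).Nonempty := nonempty_image_ι U hOd.nonempty
  haveI : IsIso (ρ ∣_ (U.ι ''ᵁ O)) := isIso_morphismRestrict_image_of_isPullback hsq O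
  exact ⟨ProperModel.ofModification P ρ (U.ι ''ᵁ O) hne,
    ProperModel.ofModificationHom P ρ (U.ι ''ᵁ O) hne, s, hs, hsq⟩

/-- **The capstone with the weaker named fact**: Nagata 1962 over a field, strong resolution of
sandwiched schemes for every prime, and nothing else, give the crux `PatchingRel`
(the two-piece gluing input is the tree theorem `OpenGluing_holds`). [folklore] -/
theorem patchingRel_of_nagataOverField_of_sandwiched (hN : NagataCompactificationOverField.{0})
    (hS : ∀ p : ℕ, p.Prime → SandwichedStrongResolution.{0} p) :
    Summit.ResolutionOfSingularities.ResolutionOfSingularities.Theses.Valuative.PatchingRel :=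
  fun p hp hLU =>
    resolutionInChar_of_properTwoModelPatching_of_relLU
      (SandwichedGluing.twoModelPatching_of_regLeification p
        (ProperModel.regLeification_of_local p (extension_of_overField hN)
          (SandwichedGluing.localRegLeification_of_openGluing_of_sandwiched p OpenGluing_holds
            (hS p hp)))) hLU

end DrefuteG4

end
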